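import Literature.Computability.Complexity.NTIMEPadding
import Literature.Computability.Complexity.NSubexp
import Literature.Computability.Complexity.VerifierPatching
import Literature.Computability.MetaComplexity.ChenJinWilliams2019.SparseMagnificationConverse
import Literature.Computability.MetaComplexity.ChenMcKayMurrayWilliams2019.SparseNEXPEquivalence
import HarnessLib

/-!
# Chen–McKay–Murray–Williams 2019, Theorem 7, direction (⇒) — proved

Topic: MetaComplexity / hardness magnification (`[topic Computability/MetaComplexity]`), story
`ChenMcKayMurrayWilliams2019/SparseNEXPEquivalence.lean`. That file states CMMW 2019, Theorem 7
(«NEXP ⊄ P/poly iff there is an `ε > 0` such that for every sufficiently small `β > 0` some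
`2^{n^β}`-sparse `L ∈ NTIME[2^{n^β}]` has no `n^{1+ε}`-size circuits», p. 30:3, proof p. 30:15) as two
named facts, `thm7_magnification` (⇐) and `thm7_converse` (⇒), combined in `sparseNSubexpHard_iff`.
This file **proves the direction (⇒)**, `theorem thm7_converse_holds : thm7_converse`, following the
printed one-line proof «(⇒) by padding an `NTIME[2^n]` language without `n^{2/β}`-size circuits down
to a `2^{m^β}`-sparse `L' ∈ NTIME[2^{m^β}]` without `m²`-size circuits» in the tree's vocabulary
(verifier-form `NTIME`, `Nondeterministic.lean`; the polynomial pad `polyPad` / `padPre` of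
`NTIMEPadding.lean`):

* `padPre_mem_NTIME_subexpTime` — **the machine content**: for `L ∈ NTIME(2ⁿ)` and `qβ ≥ 1`, the
  padded language `padPre q L` lies in `NTIME(subexpTime β) = NTIME(⌈2^{N^β}⌉)`. The verifier is the
  one of `padPre_mem_NTIME_two_pow` (`truncMapAux` of `TruncMapMachine.lean` around the clock
  `z ↦ expClock c 1 (polyUnpad q z)`, then the given verifier), with the finer accounting
  `2^{|polyUnpad q z|} ≤ 2·⌈2^{|z|^β}⌉` (`|polyUnpad q z|^q ≤ |z|`) and
  `poly(|z|) ≤ b·⌈2^{|z|^β}⌉ + b` (`exists_poly_le_subexpTime`);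
* `sparseNSubexpHardAt_one_of_not_NEXP_subset_PPoly` — **Theorem 7 (⇒) with `ε = 1`**: from
  `L₀ ∈ NEXP ∖ P/poly`, `padPre k L₀ ∈ NTIME(2ⁿ) ∖ P/poly` (`padPre_mem_NTIME_two_pow`,
  `karpReducible_padPre`, `mem_PPoly_of_karpReducible`), minus the empty word
  (`mem_NTIME_of_finite_ne`; `P/poly` ignores the empty word), padded by `polyPad ⌈1/β⌉`:
  in `NTIME(⌈2^{N^β}⌉)` by the first item, `2^{N^β}`-sparse by `isSparse_image_polyPad`, and
  without `c·N² + c`-size circuits by `mem_SIZE_of_image_polyPad_mem_SIZE` (else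
  `L₂ ∈ SIZE(O(n^{2q})) ⊆ P/poly`) — the two transfer lemmas of
  `ChenJinWilliams2019/SparseMagnificationConverse.lean`;
* `thm7_converse_holds` (the discharge), `sparseNSubexpHardAt_of_not_NEXP_subset_PPoly` (every
  `ε ∈ [0, 1]`), `sparseNSubexpHard_iff_of_thm7` (Theorem 7 as an `iff` modulo
  `thm7_magnification` only).

No new definition and no named fact is introduced; theorems only (private helpers marked).

## References

* L. Chen, D. M. McKay, C. D. Murray, R. R. Williams, *Relations and equivalences between circuit
  lower bounds and Karp–Lipton theorems*, CCC 2019, LIPIcs 137, Art. 30 — Thm. 7, p. 30:3 and its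
  proof, p. 30:15 [ChenMcKayMurrayWilliams2019].
* L. Chen, C. Jin, R. R. Williams, *Hardness magnification for all sparse NP languages*, FOCS 2019
  — §4.1, p. 14 (the padding `x ↦ x10^{|x|^{1/β}−|x|−1}`, `ε = 1`) [ChenJinWilliams2019].
* S. Arora, B. Barak, *Computational Complexity: A Modern Approach*, CUP 2009 — §2.6.2, Thm. 2.22
  (padding / translating upward), Def. 6.5 (`P/poly`) [AroraBarak2009].
-/

noncomputable section

namespace Literature.Computability.MetaComplexity.ChenMcKayMurrayWilliams2019

open Literature.Computability.Complexity Literature.Computability.Complexity.Nondeterministic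
open Literature.Computability.MetaComplexity.ChenJinWilliams2019
open _root_.Computability Polynomial Turing Filter

/-! ### Growth bookkeeping for the time bound `⌈2^{n^β}⌉` -/

/-- The exponential bookkeeping of the pad: if `n₀^q ≤ N` (or `n₀ = 0`) and `q·β ≥ 1` then
`2^{n₀} ≤ 2·⌈2^{N^β}⌉` (`n₀ ≤ N^{1/q} ≤ N^β`). [folklore] -/
private theorem two_pow_le_two_mul_subexpTime {β : ℝ} {q : ℕ} (hq : 1 ≤ q)
    (hqβ : 1 ≤ (q : ℝ) * β) {x₀ : List Bool} {N : ℕ} (hx : x₀.length ^ q ≤ N ∨ x₀ = []) :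
    2 ^ x₀.length ≤ 2 * subexpTime β N := by
  have hT : 1 ≤ subexpTime β N := one_le_subexpTime β N
  have h : x₀.length ^ q ≤ N ∨ x₀.length = 0 := hx.imp_right fun h => by rw [h, List.length_nil]
  set n₀ := x₀.length
  rcases Nat.eq_zero_or_pos n₀ with h0 | hn₀
  · rw [h0, pow_zero]; omega
  rcases h with h | h
  · have hN : 1 ≤ N := le_trans (Nat.one_le_pow _ _ hn₀) h
    have hq0 : (0 : ℝ) < q := by exact_mod_cast hq
    have h1 : ((n₀ : ℝ) ^ (q : ℕ)) ≤ (N : ℝ) := by exact_mod_cast h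
    have h2 : (n₀ : ℝ) = ((n₀ : ℝ) ^ (q : ℕ)) ^ ((1 : ℝ) / q) := by
      rw [← Real.rpow_natCast, ← Real.rpow_mul (Nat.cast_nonneg _), mul_one_div_cancel hq0.ne',
        Real.rpow_one]
    have h3 : (n₀ : ℝ) ≤ (N : ℝ) ^ ((1 : ℝ) / q) := by
      rw [h2]
      exact Real.rpow_le_rpow (by positivity) h1 (by positivity)
    have h4 : (N : ℝ) ^ ((1 : ℝ) / q) ≤ (N : ℝ) ^ β :=
      Real.rpow_le_rpow_of_exponent_le (by exact_mod_cast hN)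
        (by rw [div_le_iff₀ hq0]; linarith)
    have h5 : (2 : ℝ) ^ (n₀ : ℝ) ≤ (2 : ℝ) ^ ((N : ℝ) ^ β) :=
      Real.rpow_le_rpow_of_exponent_le one_le_two (h3.trans h4)
    have h6 : ((2 ^ n₀ : ℕ) : ℝ) ≤ (subexpTime β N : ℝ) := by
      rw [Nat.cast_pow, Nat.cast_ofNat, ← Real.rpow_natCast]
      exact h5.trans (Nat.le_ceil _)
    have h7 : 2 ^ n₀ ≤ subexpTime β N := by exact_mod_cast h6
    omega
  · omega

/-! ### The padded language of an `NTIME(2ⁿ)` language is in `NTIME(⌈2^{n^β}⌉)` -/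

/-- **Polynomial padding into `NTIME[2^{n^β}]`** (the machine content of "pad an `NTIME[2^n]`
language down to a `2^{m^β}`-sparse `L' ∈ NTIME[2^{m^β}]`", CMMW 2019 p. 30:15). Given a verifier
`(c, R, M)` of `L ∈ NTIME(2ⁿ)` and `q` with `qβ ≥ 1`, the verifier of `padPre q L` on `⟨z, y⟩` is —
exactly as in `padPre_mem_NTIME_two_pow` — the truncating wrapper `truncMapAux` of the clock
`z ↦ ⟨x₀, 1^{c·2^{n₀}+c}⟩`, `x₀ = polyUnpad q z`, `n₀ = |x₀|` (`polyUnpad q ∈ FP`, then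
`expClock c 1`), followed by `M`; since `n₀^q ≤ |z|`, `2^{n₀} ≤ 2·⌈2^{|z|^β}⌉`, and the polynomial
overhead is `O(⌈2^{|z|^β}⌉)` too. [cite: ChenMcKayMurrayWilliams2019, proof of Thm. 7, p. 30:15] -/
theorem padPre_mem_NTIME_subexpTime {L : Language Bool} {q : ℕ} {β : ℝ} (hβ : 0 < β)
    (hq : 1 ≤ q) (hqβ : 1 ≤ (q : ℝ) * β) (hL : L ∈ NTIME (fun n => 2 ^ n)) :
    padPre q L ∈ NTIME (subexpTime β) := by
  obtain ⟨c, R, M, hM, hLR⟩ := hL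
  -- the clock machine `z ↦ expClock c 1 (polyUnpad q z)`
  obtain ⟨p₁, U, hU⟩ := polyUnpad_mem_FP q
  obtain ⟨C, Ck, hCk⟩ := exists_timeComputable_expClock c (le_refl 1)
  have hNc : ∀ z : List Bool, (U.comp Ck).OutputsWithin z (expClock c 1 (polyUnpad q z))
      ((p₁ + Polynomial.C C).eval z.length + C * 2 ^ (polyUnpad q z).length) := by
    intro z
    have h := Turing.TM2ComputableAux.comp_outputsWithin U Ck (hU z) (hCk (polyUnpad q z))
    refine h.mono ?_
    simp only [id, eval_add, eval_C, pow_one]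
    omega
  obtain ⟨b, hb⟩ := exists_poly_le_subexpTime (p₁ + Polynomial.C C + 5 * X + 11) hβ
  -- the verifier
  let V : TM2ComputableAux Bool Bool := (truncMapAux (U.comp Ck)).comp M
  let B : List Bool → ℕ := fun z => c * 2 ^ (polyUnpad q z).length + c
  let K : ℕ := b + 4 * (3 * c + C)
  refine ⟨2 * K + 2 * b + 2, fun z y => R (polyUnpad q z) (y.take (B z)), V,
    fun z y hy => ?_, fun z => ?_⟩
  · -- running time
    set x₀ := polyUnpad q z with hx₀
    set n₀ := x₀.length with hn₀
    have hclock := hNc z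
    rw [← hx₀] at hclock
    have h₁ := outputsWithin_truncMapAux_boolPair (U.comp Ck) (y := y) hclock
    simp only [List.length_replicate, pow_one, ← hn₀] at h₁
    have hy' : (y.take (c * 2 ^ n₀ + c)).length ≤ c * 2 ^ n₀ + c := List.length_take_le _ _
    have h₂ : M.OutputsWithin (boolPair x₀ (y.take (c * 2 ^ n₀ + c)))
        (encodeBool (R x₀ (y.take (c * 2 ^ n₀ + c)))) (c * 2 ^ n₀ + c) := by
      have := hM x₀ (y.take (c * 2 ^ n₀ + c)) hy'
      rwa [← hn₀] at this
    have h := Turing.TM2ComputableAux.comp_outputsWithin _ _ h₁ h₂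
    have hBz : B z = c * 2 ^ n₀ + c := by simp [B, hn₀, hx₀]
    rw [show (fun z y => R (polyUnpad q z) (List.take (B z) y)) z y =
      R x₀ (y.take (c * 2 ^ n₀ + c)) by simp [hBz, hx₀]]
    refine h.mono ?_
    -- the estimates
    set T := subexpTime β z.length with hT
    have hpow : 2 ^ n₀ ≤ 2 * T := by
      rw [hn₀, hx₀, hT]
      exact two_pow_le_two_mul_subexpTime hq hqβ (length_polyUnpad_pow_le q z)
    have hn₀z : n₀ ≤ z.length := by rw [hn₀, hx₀]; exact length_polyUnpad_le q z
    have hbz := hb z.length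
    simp only [eval_add, eval_mul, eval_ofNat, eval_X, eval_C] at hbz
    have e1 : c * 2 ^ n₀ ≤ c * (2 * T) := Nat.mul_le_mul_left c hpow
    have e2 : C * 2 ^ n₀ ≤ C * (2 * T) := Nat.mul_le_mul_left C hpow
    have hy2 : 2 * (y.length / 2) ≤ (2 * K + 2 * b + 2) * T + (2 * K + 2 * b + 2) :=
      (Nat.mul_div_le y.length 2).trans hy
    have hT1 : 1 ≤ T := one_le_subexpTime β _
    simp only [K, eval_add, eval_C] at hy2 ⊢
    nlinarith [e1, e2, hbz, hy2, hn₀z, hT1]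
  · -- correctness
    rw [mem_padPre, hLR (polyUnpad q z)]
    set x₀ := polyUnpad q z with hx₀
    have hBz : B z = c * 2 ^ x₀.length + c := rfl
    have hpow : 2 ^ x₀.length ≤ 2 * subexpTime β z.length :=
      two_pow_le_two_mul_subexpTime hq hqβ (length_polyUnpad_pow_le q z)
    constructor
    · rintro ⟨y₀, hy₀, hR⟩
      refine ⟨y₀, ?_, ?_⟩
      · have e1 : c * 2 ^ x₀.length ≤ c * (2 * subexpTime β z.length) :=
          Nat.mul_le_mul_left c hpow
        simp only [K]
        nlinarith [e1, hy₀, one_le_subexpTime β z.length]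
      · simp only [hBz]
        rwa [List.take_of_length_le hy₀]
    · rintro ⟨y, -, hR⟩
      exact ⟨y.take (B z), List.length_take_le _ _, hR⟩

/-! ### Language-level bookkeeping -/

/-- Without the empty word, the padded language `padPre q L` is exactly the image `polyPad q '' L`
(invalid words unpad to `ε ∉ L`). [folklore] -/
private theorem padPre_eq_image_polyPad {L : Language Bool} (q : ℕ) (hL : [] ∉ L) :
    padPre q L = polyPad q '' L := by
  ext z
  rw [mem_padPre]
  constructor
  · intro hz
    rcases polyUnpad_dichotomy q z with h | h
    · exact ⟨polyUnpad q z, hz, h.symm⟩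
    · rw [h] at hz
      exact (hL hz).elim
  · rintro ⟨x, hx, rfl⟩
    rwa [polyUnpad_polyPad]

/-- `P/poly` ignores the empty word: if `L₂ ∈ P/poly` and `L₁` agrees with `L₂` on all non-empty
words, then `L₁ ∈ P/poly` (patch the circuit on `0` inputs by a constant). [folklore] -/
private theorem mem_PPoly_of_agree_off_nil {L₁ L₂ : Language Bool} (h₂ : L₂ ∈ PPoly)
    (h : ∀ x : List Bool, x ≠ [] → (x ∈ L₁ ↔ x ∈ L₂)) : L₁ ∈ PPoly := by
  simp only [PPoly, Set.mem_iUnion] at h₂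
  obtain ⟨p, C, hC, hdec⟩ := h₂
  let C' : CircuitFamily := fun n =>
    match n with
    | 0 => Circuit.const (Fin 0) ((L₁ : Set (List Bool)).boolIndicator [])
    | n + 1 => C (n + 1)
  refine Set.mem_iUnion.2 ⟨p + 1, C', fun n => ?_, fun x => ?_⟩
  · cases n with
    | zero =>
      refine ⟨?_, ?_⟩
      · intro g hg
        have hg' : g = ⟨0, fun _ => (L₁ : Set (List Bool)).boolIndicator [], Fin.elim0⟩ :=
          List.mem_singleton.1 hg
        subst hg'
        show (0 : ℕ) ≤ 2
        exact Nat.zero_le 2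
      · show (Circuit.const (Fin 0) _).size ≤ (p + 1).eval 0
        simp [Circuit.size, Circuit.const]
    | succ n =>
      refine ⟨(hC (n + 1)).1, ?_⟩
      show (C (n + 1)).size ≤ (p + 1).eval (n + 1)
      rw [eval_add, eval_one]
      exact (hC (n + 1)).2.trans (Nat.le_succ _)
  · cases x with
    | nil =>
      show (Circuit.const (Fin 0) ((L₁ : Set (List Bool)).boolIndicator [])).eval _ = _
      rw [Circuit.eval_const]
    | cons a t =>
      show (C (t.length + 1)).eval (a :: t).get = (L₁ : Set (List Bool)).boolIndicator (a :: t)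
      have hd := hdec (a :: t)
      simp only [List.length_cons] at hd
      rw [hd]
      have hiff := h (a :: t) (List.cons_ne_nil a t)
      by_cases hx : (a :: t) ∈ L₂
      · rw [(Set.mem_iff_boolIndicator _ _).1 hx, (Set.mem_iff_boolIndicator _ _).1 (hiff.2 hx)]
      · rw [(Set.notMem_iff_boolIndicator _ _).1 hx,
          (Set.notMem_iff_boolIndicator _ _).1 (fun h' => hx (hiff.1 h'))]

/-! ### Theorem 7, direction (⇒) -/

/-- **CMMW 2019, Theorem 7 (⇒), quantitative form: `NEXP ⊄ P/poly ⇒ SparseNSubexpHardAt 1`** — the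
printed padding argument (p. 30:15: "(⇒) by padding an `NTIME[2^n]` language without `n^{2/β}`-size
circuits down to a `2^{m^β}`-sparse `L' ∈ NTIME[2^{m^β}]` without `m²`-size circuits"), in the
tree's vocabulary. From `NEXP ⊄ P/poly` pick `L₀ ∈ NTIME(2^{nᵏ}) ∖ P/poly`; its padded version
`L₁ = padPre k L₀ ∈ NTIME(2ⁿ)` (`padPre_mem_NTIME_two_pow`) is still outside `P/poly`
(`L₀ ≤ₚ L₁`, `mem_PPoly_of_karpReducible`), and so is `L₂ = L₁ ∖ {ε} ∈ NTIME(2ⁿ)`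
(`mem_NTIME_of_finite_ne`). For `β ∈ (0, 1)` and `q = ⌈1/β⌉` the language
`L' = padPre q L₂ = polyPad q '' L₂` is in `NTIME(⌈2^{N^β}⌉)` (`padPre_mem_NTIME_subexpTime`), is
`2^{N^β}`-sparse (`isSparse_image_polyPad`), and `L' ∈ SIZE(c·N² + c)` would give
`L₂ ∈ SIZE(O(n^{2q})) ⊆ P/poly` (`mem_SIZE_of_image_polyPad_mem_SIZE`), a contradiction.
[cite: ChenMcKayMurrayWilliams2019, Thm. 7 (⇒), proof p. 30:15] -/
theorem sparseNSubexpHardAt_one_of_not_NEXP_subset_PPoly (h : ¬ (NEXP ⊆ PPoly)) :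
    SparseNSubexpHardAt 1 := by
  obtain ⟨L₀, hL₀, hL₀P⟩ := Set.not_subset.1 h
  simp only [NEXP, Set.mem_iUnion] at hL₀
  obtain ⟨k, hk⟩ := hL₀
  -- down to `NTIME(2ⁿ)`
  have hL₁ : padPre k L₀ ∈ NTIME (fun n => 2 ^ n) := padPre_mem_NTIME_two_pow hk
  have hL₁P : padPre k L₀ ∉ PPoly := fun h' =>
    hL₀P (mem_PPoly_of_karpReducible (karpReducible_padPre k L₀) h')
  -- drop the empty word
  obtain ⟨L₂, hL₂⟩ : ∃ L₂ : Language Bool, ∀ x : List Bool, x ∈ L₂ ↔ x ∈ padPre k L₀ ∧ x ≠ [] :=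
    ⟨{x | x ∈ padPre k L₀ ∧ x ≠ []}, fun _ => Iff.rfl⟩
  have hL₂N : L₂ ∈ NTIME (fun n => 2 ^ n) := by
    refine mem_NTIME_of_finite_ne TimeConstructible.isTimeConstructible_two_pow hL₁
      ((Set.finite_singleton ([] : List Bool)).subset fun x hx => ?_)
    by_contra hne
    exact hx (by rw [hL₂]; exact ⟨fun h => h.1, fun h => ⟨h, hne⟩⟩)
  have hL₂P : L₂ ∉ PPoly := fun h' =>
    hL₁P (mem_PPoly_of_agree_off_nil h' fun x hx => by
      rw [hL₂]; exact ⟨fun h => ⟨h, hx⟩, fun h => h.1⟩)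
  have hnil : [] ∉ L₂ := fun h' => ((hL₂ _).1 h').2 rfl
  refine ⟨1, one_pos, fun β hβ0 _ => ?_⟩
  have hq : 1 ≤ ⌈1 / β⌉₊ := Nat.ceil_pos.2 (by positivity)
  have hqβ : 1 ≤ (⌈1 / β⌉₊ : ℝ) * β := by
    have h1 : 1 / β ≤ (⌈1 / β⌉₊ : ℝ) := Nat.le_ceil _
    have h2 : 1 / β * β = 1 := div_mul_cancel₀ 1 hβ0.ne'
    nlinarith
  have hpad : padPre ⌈1 / β⌉₊ L₂ = polyPad ⌈1 / β⌉₊ '' L₂ := padPre_eq_image_polyPad _ hnil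
  refine ⟨padPre ⌈1 / β⌉₊ L₂, padPre_mem_NTIME_subexpTime hβ0 hq hqβ hL₂N, ?_, fun c hc => ?_⟩
  · rw [hpad]
    exact isSparse_image_polyPad hβ0 hqβ L₂
  · rw [hpad] at hc
    have hS := mem_SIZE_of_image_polyPad_mem_SIZE hq hc
    refine hL₂P (SIZE_subset_PPoly
      (Polynomial.C (30 * (c + 1)) * X ^ (2 * ⌈1 / β⌉₊) + Polynomial.C (30 * (c + 1)))
      (fun n => ?_) hS)
    simp [polyBound]

/-- **Discharge of the named fact `thm7_converse`** (CMMW 2019, Theorem 7, direction (⇒)): with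
`ε = 1` from `sparseNSubexpHardAt_one_of_not_NEXP_subset_PPoly`. [cite: ChenMcKayMurrayWilliams2019, Thm. 7 (⇒), proof p. 30:15] -/
theorem thm7_converse_holds : thm7_converse :=
  fun h => ⟨1, one_pos, sparseNSubexpHardAt_one_of_not_NEXP_subset_PPoly h⟩

/-- Every exponent `ε ∈ [0, 1]` works in Theorem 7 (⇒) (`SparseNSubexpHardAt.mono`). [cite: ChenMcKayMurrayWilliams2019, Thm. 7 (⇒), proof p. 30:15] -/
theorem sparseNSubexpHardAt_of_not_NEXP_subset_PPoly (h : ¬ (NEXP ⊆ PPoly)) {ε : ℝ}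
    (hε0 : 0 ≤ ε) (hε1 : ε ≤ 1) : SparseNSubexpHardAt ε :=
  (sparseNSubexpHardAt_one_of_not_NEXP_subset_PPoly h).mono hε0 hε1

/-- **Theorem 7 as an equivalence, modulo the magnification direction only**: the hypothesis
`thm7_converse` of `sparseNSubexpHard_iff` is now discharged. [cite: ChenMcKayMurrayWilliams2019, Thm. 7] -/
theorem sparseNSubexpHard_iff_of_thm7 (h : thm7_magnification) :
    (∃ ε : ℝ, 0 < ε ∧ SparseNSubexpHardAt ε) ↔ ¬ (NEXP ⊆ PPoly) :=
  sparseNSubexpHard_iff h thm7_converse_holds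

end Literature.Computability.MetaComplexity.ChenMcKayMurrayWilliams2019
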